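import Mathlib.RingTheory.MvPolynomial.WeightedHomogeneous
import Mathlib.Algebra.MvPolynomial.Supported
import Mathlib.RingTheory.Ideal.Quotient.Operations
import Mathlib.RingTheory.Ideal.Maps
import Mathlib.Data.Sym.Sym2
import HarnessLib

/-!
# Hu 2025 (arXiv:2507.21400v1, Part I), §4.1 + start of §4.2 — `R_0 ⊂ R_[k] ⊂ R`, ϱ- and ϖ-variables, `φ_[k]`,
# `ker^mh φ_[k]`, the models `𝕌_[k]`, `𝒱_[k]` by their ideals, ℘-binomials: INTERFACE I-R of PARTITION-HU
# row 103 (file `S04ModelV/R103aModelR`), STATEMENTS-FIRST (LADDER-RESOLUTION rung M-Hu-min, D-0089)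

**Status of the source (D-0012): UNREFEREED PREPRINT UNDER ADJUDICATION.** Y. Hu, *Universal
characteristic-free resolution of singularities, I*, arXiv:2507.21400v1 (2025-07-29), 162 pp. [Hu2025].
Text of record = lit key `paper:arxiv-2507.21400` (TeX-source chunks `p0001…p0073.txt`; here chunk p0021 and
p0022 l.1–45, locators «chunk p00cc l.a–b»); cross-check = the PDF page texts of res-lit-6,
`HOME/lit/res-lit-6/hu25/text/hu25_pNNN.txt`, pp.44–47 (locators «p.N L0aa–L0bb» = THOSE files' line
numbers; equation numbers (4.1)–(4.8) and the PRINTED item numbers Def 4.1 / Lem 4.2 / Def 4.3 / Lem 4.4 /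
Lem 4.5 / Def 4.6 / Def 4.7 are the PDF's — the chunk text numbers every §4 item after Def 4.1 one lower,
PARTITION-HU §0 CUSTODY ERRATUM; decl names follow the PDF, docstrings carry both). Pre-draft by
res-type-024 (sha16 dc4d5b12568496ff, 2026-08-27T02:59Z); every locator RE-READ on the chunk and on the PDF
text and the file filed by the row-103 typer of record res-type-042 (T9); decl names and signatures are
the pre-draft's, on which rows 104/105 were drafted (one body corrected: `Eq4_1` now uses the unordered pair
`Sym2.mk u v` — the pre-draft's `Sym2.mk (ends t)` was a partial application of the curried constructor). NOTHING from the preprint is asserted: definitions are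
real Lean definitions, the printed lemmas are `def … : Prop` CANDIDATE STATEMENTS tagged
`[claim: Hu2025, status: under-review]`. No proofs, no `sorry`, no `instance`, no notation.
STATUS: candidate statements under adjudication (D-0012/D-0089); not asserted.

HONEST CEILING (PARTITION-HU header): Part I as printed claims resolution of singularity TYPES; the
summit-type claim rests on the UNPOSTED Part II. AI typing/adjudication is weaker than expert review.

## Carrier level and genericity (PARTITION-HU §1, «CARRIER LEVEL»)

Everything is typed over COMMUTATIVE ALGEBRA and GENERICALLY in the platform data of rows 101/102, so
that this file elaborates (and can land) independently of `S03Pluecker/R101aPlatform.lean` (I-PL) and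
`R102aOrders.lean` (I-ORD); the row-103 owner instantiates each carrier by a one-line `abbrev` once those
files are in the tree. The parameters and their intended instantiation:

* `k` — the base field/ring `𝕜` (chunk p0021 l.110 «`R_0 = 𝕜[x_u]`»); any commutative ring here.
* `σ` — the index type of the ϖ-VARIABLES `x_u`, `u ∈ 𝕀_{3,n} ∖ m` (I-PL: `PVar n`), so that
  `R0 σ k = MvPolynomial σ k` IS I-PL's `ChartRing n k`, the coordinate ring of the chart `𝕌`.
* `𝔗` — the index type of the de-homogenised m-primary relations `F̄ ∈ 𝓕` (I-PL: `{u : plIndex n // IsLt u.1}`,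
  Def 3.4); `Φ : Set 𝔗` = the relations «in play» (printed `𝓕_[k] = {F̄_1 < ⋯ < F̄_k}` of Def 3.15 is
  `Φ = 𝓕_[k]`; `Φ = univ` is `k = Υ`); an arbitrary `Φ` is a GENERALITY of the rendering, not of the text.
* `T` — the index type of ALL TERMS `s ∈ S_F` of all `F̄ ∈ 𝓕` (I-ORD: the entries of `primaryTerms u`),
  with `rel : T → 𝔗` («the `F` the term belongs to») and `mono : T → (σ →₀ ℕ)` = the exponent vector of
  the chart monomial `x̄_{u_s} x̄_{v_s}` of the term (with `x̄_m = 1`, I-PL `xbar`; so the leading term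
  `s_F` of `F̄_{m,u}` has `mono = x_u`). By Def. 4.1 the ϱ-VARIABLES `x_(u_s,v_s)` of `ℙ_F` are indexed by
  the terms `s ∈ S_F`, i.e. by `T`; the printed convention (4.1) «`x_(u_s,v_s) = x_(v_s,u_s)`» is the
  statement that this indexing by UNORDERED pairs is unambiguous (`Eq4_1`).

## Transcription (printed item → locator of record; PDF cross-check → decls; verbatim text in the decl docstrings)

* `ℙ_F`, `[x_(u_s,v_s)]_{s ∈ S_F}` → chunk p0021 l.16–21; p.44 L010–L015 → the block `Sum.inr t`, `rel t = F`,
  of `ModelRing σ T k` (`rhoVar`); no separate scheme `ℙ_F`.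
* (4.1) convention `x_(u_s,v_s) = x_(v_s,u_s)` → p0021 l.22–30; p.44 L016–L020 → `Eq4_1`.
* Def. 4.1 ϱ- and ϖ-variables, «`x_m = 1`» → p0021 l.32–35; p.44 L021–L022 → `rhoVar`, `varpiVar`, `IsRhoVar` =
  `Def4_1`, `IsVarpiVar` (`x_m = 1` is I-PL's `xbar`, inside `mono`).
* (4.2) `Θ_[k]`, (4.3) `Θ_{[k],Gr}`, (4.5) `𝕌_[k]`, (4.4) `𝒱_[k]`, «`𝒱 := 𝒱_[Υ]`» → p0021 l.40–51 / l.52–58 /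
  l.78–87 / l.60–76; p.44 L025–L034 / L035–L040 / p.45 L008–L013 / p.44 L041–p.45 L007 → `graphMap` (graph
  parametrisation), `modelUIdeal`, `modelVIdeal` (`Φ = univ` for `𝒱`, `ℛ`).
* PDF Lem. 4.2 p.45 L014–L027 (torus equivariance; ABSENT from the chunk text — custody erratum) and the
  diagram (4.6) p.45 L028–L042: NOT typed here ([OPT] in PARTITION-HU row 103; needs the torus of row 101).
* Def. 4.3 ‹chunk Def. 4.2› `R_0`, `R_[k]`, multi-homogeneous, ϱ-linear; «`R := R_[Υ]`» → p0021 l.107–120,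
  l.134–136; p.46 L005–L010, L017–L018 → `R0`, `ModelRing`, `toModel`, `RSub` = `Rk` = `Def4_3`, `blockWeight`,
  `IsMultiHomogeneous`, `IsRhoLinear`.
* (4.7) `φ_[k]`, «`φ := φ_[Υ]`», `ker^mh φ_[k]` → p0021 l.122–140; p.46 L011–L019 → `img`, `varphi`, `kerMH`
  (`φ_[k]` = restriction of the one map `φ` to `R_[k] ⊂ R`, which is how p0021 l.158–161 / p.46 L027–L028
  «`f ∈ ker φ_[k] ⟺ f ∈ ker φ`» reads — by construction, no decl).
* Lem. 4.4 ‹chunk Lem. 4.3› → p0021 l.142–150; p.46 L020–L024 → `Lem4_4`.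
* «it suffices to consider binomials `m − m′ ∈ ker^mh φ_[k]`» (argument p0021 l.166–p0022 l.4) → p0022 l.5–6;
  p.46 L030–p.47 L015 → `C22L5`.
* Lem. 4.5 ‹chunk Lem. 4.4› / (4.8) (sic «`ker^mh φ̄_[k]`», the bar printed in chunk AND PDF, never introduced)
  → p0022 l.10–21; p.47 L017–L022 → `wpBinomial`, `Lem4_5`.
* Def. 4.6 ‹chunk Def. 4.5› `B^℘_[k]` → p0022 l.23–27; p.47 L023–L025 → `wpBinomials` = `Def4_6`.
* Def. 4.7 ‹chunk Def. 4.6› ℘-reducible / ℘-irreducible → p0022 l.29–45; p.47 L026–L032 → `monoR`,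
  `IsWpReducible` = `Def4_7`, `IsWpIrreducible`.
* NOT in this file (row 103 file `b` = `R103bDescendants.lean`): «no common factor» p0022 l.70–72, Lem. 4.8 /
  4.9 / Cor. 4.10 ‹chunk 4.7–4.9› [OPT], Def. 4.11 ‹chunk 4.10› p0022 l.153–173, Def. 4.12 ‹chunk 4.11›
  p0023 l.5–26.

## Rendering choices (for the faithfulness lanes; each is a choice, none takes a side)

* ONE AMBIENT RING. `R = R_[Υ] = 𝕜[x_u][x_(u_s,v_s) : all s, all F]` is `ModelRing σ T k = MvPolynomial
  (σ ⊕ T) k`; the printed inclusions `R_0 ⊂ R_[k] ⊂ R` (chunk p0021 l.158 «`f ∈ R_[k] (⊂ R)`») are literal: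
  `R_Φ := MvPolynomial.supported k (ϖ-variables ∪ ϱ-variables of the F ∈ Φ)` is a `k`-subalgebra of `R`
  (`RSub`), and `R0 σ k = MvPolynomial σ k` embeds by `toModel = rename Sum.inl` (image = `RSub … ∅`).
  Ideals «of `R_[k]`» are rendered as ideals of `R` GENERATED by subsets of `R_[k]` (so that all ideals
  live in one ring); an ideal of the ring `R_[k]` proper is recovered by intersecting.
* `ℛ_[k] = 𝕌 × Π ℙ_{F_i}` is carried by the multi-graded ring `R_[k]` (grading `blockWeight`); CLOSED
  SUBSCHEMES of `ℛ_[k]` are carried by ideals of `R` generated by multi-homogeneous elements of `R_[k]`.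
  Mathlib has no multi-`Proj`; the scheme `ℛ_[k]` itself is not constructed (PARTITION-HU §1: scheme-level
  objects are row 110's, and from Prop. 4.54 on the text itself works chart by chart).
* «closure of the graph of `Θ_[k]`» (4.5) is rendered by its defining property: the multi-homogeneous
  ideal of the scheme-theoretic closure of the graph of the monomial map `x ↦ ([x̄_{u_s}x̄_{v_s}]_s)_i` is the
  kernel of the graph parametrisation `ψ : R → R_0[t_F : F ∈ 𝔗]`, `x_u ↦ x_u`, `x_(u_s,v_s) ↦
  x̄_{u_s}x̄_{v_s}·t_F` (`graphMap` at `ev = id`), cut back to `R_[k]`: `modelUIdeal Φ = ⟨ker ψ ∩ R_Φ⟩`. For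
  `𝒱_[k]` (4.4) the same with `R_0` replaced by `R_0/⟨𝓕⟩`, the coordinate ring of `𝕌_Gr` (Prop. 3.6; a
  domain by Prop. 3.6's second sentence, not used here): `modelVIdeal`. With this rendering Lem. 4.4 says
  `⟨ker ψ ∩ R_Φ⟩ = ⟨ker^mh φ_Φ⟩` — «immediate», as printed (a multi-homogeneous `f` lies in `ker ψ` iff
  `φ(f) = 0`, and `ker ψ` is multi-homogeneous); it is typed, not proved. DEPENDENCE (for the lanes, res-ref-b12
  N103-1): `⟨ker ψ_A ∩ R_Φ⟩` is the multi-homogeneous ideal of the scheme-theoretic closure of the graph exactly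
  when (i) the base `A` (`R_0`, resp. `R_0/⟨𝓕⟩`) is reduced and (ii) the rational map is defined on a dense open
  of `Spec A` (in every block some chart monomial `x̄_{u_s}x̄_{v_s}` vanishes identically on no component); the
  text mentions neither — both hold on the platform (`R_0` a polynomial ring; `𝕌_Gr` an affine space, Prop. 3.6).
* `mono : T → (σ →₀ ℕ)` records the chart monomial of a term as an EXPONENT VECTOR (so that Def. 4.7's
  divisibility of monomials is order on exponents, Mathlib `Finsupp` `≤`); `img t = monomial (mono t) 1`.
* Scope words are binders: «Fix `k ∈ [Υ]`» = the parameter `Φ`; «Fix any `i ∈ [k]`» (Lem. 4.5) =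
  `rel t ∈ Φ`; «two distinct ϱ-variables of `ℙ_{F_i}`» = `rel t = rel t′ ∧ t ≠ t′`; «nonzero binomial»
  (Def. 4.6/4.7) explicit.

Source: Y. Hu, arXiv:2507.21400v1 (2025), §4.1–§4.2: chunk p0021 l.1–p0022 l.45; PDF pp.44–47, eqs. (4.1)–(4.8),
Def. 4.1, 4.3, Lem. 4.4, 4.5, Def. 4.6, 4.7. [Hu2025] (ADJUDICATED, not cited as fact)
-/

noncomputable section

namespace Literature.AlgebraicGeometry.Hu2025.Statements.S04ModelV

open MvPolynomial

universe u v w x y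

variable {k : Type u} [CommRing k] {σ : Type v} {T : Type w} {𝔗 : Type x}

/-! ## Def. 4.3 (chunk p0021 l.107–111; p.46 L005–L006) — the rings `R_0 ⊂ R_[k] ⊂ R` -/

/-- **Hu 2025, Def. 4.3, `R_0`** (chunk p0021 l.110; PDF p.46 L006): «`R_0 = 𝕜[x_u]_{u ∈ 𝕀_{3,n} ∖ m}`» —
the polynomial ring on the ϖ-variables; at `σ = PVar n` this is I-PL's `ChartRing n k` (Def. 3.5, the
coordinate ring of the chart `𝕌`). [claim: Hu2025, status: under-review]
STATUS: candidate statement under adjudication (D-0012/D-0089); not asserted. -/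
abbrev R0 (σ : Type v) (k : Type u) [CommRing k] : Type (max v u) := MvPolynomial σ k

/-- **Hu 2025, Def. 4.3 with p.46 L017–L018, the ring `R := R_[Υ]`** (chunk p0021 l.110–111, l.134–136):
«`R_[k] = R_0[x_(v_s,u_s)]_{s ∈ S_{F_i}, i ∈ [k]}`», «`R := R_[Υ]`» — ALL ϖ-variables (`Sum.inl s`, `s : σ`)
and ALL ϱ-variables (`Sum.inr t`, `t : T` a term of some `F̄ ∈ 𝓕`) adjoined to `𝕜`; the intermediate
`R_[k]` are the subalgebras `RSub` of this one ring (module docstring, ONE AMBIENT RING).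
[claim: Hu2025, status: under-review]
STATUS: candidate statement under adjudication (D-0012/D-0089); not asserted. -/
abbrev ModelRing (σ : Type v) (T : Type w) (k : Type u) [CommRing k] : Type (max (max v w) u) :=
  MvPolynomial (σ ⊕ T) k

/-- The literal inclusion `R_0 ⊂ R` (chunk p0021 l.110–111; p.46 L007: `R_[k] = R_0[…]`): the `𝕜`-algebra
map renaming `x_u` to the ϖ-variable `x_u` of `R`. Plumbing. [claim: Hu2025, status: under-review]
STATUS: candidate statement under adjudication (D-0012/D-0089); not asserted. -/
def toModel : R0 σ k →ₐ[k] ModelRing σ T k :=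
  rename Sum.inl

/-! ## Def. 4.1 (chunk p0021 l.16–35; p.44 L010–L022) — ϱ-variables and ϖ-variables; convention (4.1) -/

/-- **Hu 2025, Def. 4.1, the ϱ-variable `x_(u_s,v_s)` of `ℙ_F`** (chunk p0021 l.20–21, l.32–33; PDF p.44
L015, L021): «we let `ℙ_F` be the projective space with homogeneous coordinates written as
`[x_(u_s,v_s)]_{s ∈ S_F}` … We call `x_(u_s,v_s)` a ϱ-variable of `ℙ_F`, or simply a ϱ-variable.» — the
variable of `R` indexed by the TERM `t` (= `s ∈ S_F`, `F = rel t`). [claim: Hu2025, status: under-review]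
STATUS: candidate statement under adjudication (D-0012/D-0089); not asserted. -/
def rhoVar (t : T) : ModelRing σ T k :=
  X (Sum.inr t)

/-- **Hu 2025, Def. 4.1, the ϖ-variable `x_u`** (chunk p0021 l.34–35; PDF p.44 L021–L022): «To distinguish, we
call a Plücker variable, `x_u` with `u ∈ 𝕀_{3,n} ∖ m`, a ϖ-variable. By convention, `x_m = 1`.» — the
variable of `R` indexed by `s : σ` (the convention `x_m = 1` is I-PL's `xbar`, used in `mono`).
[claim: Hu2025, status: under-review]
STATUS: candidate statement under adjudication (D-0012/D-0089); not asserted. -/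
def varpiVar (s : σ) : ModelRing σ T k :=
  X (Sum.inl s)

/-- **Hu 2025, Def. 4.1** (chunk p0021 l.32–35; p.44 L021–L022): the predicate «is a ϱ-variable» on the
variables `σ ⊕ T` of `R` (the right summand). [claim: Hu2025, status: under-review]
STATUS: candidate statement under adjudication (D-0012/D-0089); not asserted. -/
def IsRhoVar (i : σ ⊕ T) : Prop :=
  ∃ t : T, i = Sum.inr t

/-- **Hu 2025, Def. 4.1** (chunk p0021 l.34–35; p.44 L021–L022): the predicate «is a ϖ-variable» on the
variables `σ ⊕ T` of `R` (the left summand). [claim: Hu2025, status: under-review]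
STATUS: candidate statement under adjudication (D-0012/D-0089); not asserted. -/
def IsVarpiVar (i : σ ⊕ T) : Prop :=
  ∃ s : σ, i = Sum.inl s

/-- **Hu 2025, Def. 4.1** — numbered alias of `IsRhoVar` (chunk p0021 l.32–35; p.44 L021–L022).
[claim: Hu2025, status: under-review]
STATUS: candidate statement under adjudication (D-0012/D-0089); not asserted. -/
abbrev Def4_1 (i : σ ⊕ T) : Prop := IsRhoVar i

/-- **Hu 2025, (4.1)** (chunk p0021 l.22–30; PDF p.44 L016–L020): «For convenience, we make a convention:
`x_(u_s,v_s) = x_(v_s,u_s)`, `∀ s ∈ S_F`. (If we write `(u_s,v_s)` in the lexicographical order … the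
ambiguity is automatically avoided. However, the convention allows flexibility of writing.)» Rendered on
the term bookkeeping of rows 101/102 (`ends t = (u_s, v_s)`, the index pair of the term `t`; I-ORD
`PlTerm.us/vs`): the ϱ-variables of one `ℙ_F` are NAMED BY UNORDERED PAIRS, i.e. `t ↦ (F, {u_s, v_s})`
(Mathlib `Sym2`, the UNORDERED pair `s(u_s, v_s) = Sym2.mk u_s v_s`) is injective — the well-definedness the
convention presupposes. A CONVENTION, typed so that the lanes can check it on the explicit term lists; not a
claim of substance. (res-type-042, T9: the pre-draft's `Sym2.mk (ends t)` was a partial application of the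
curried constructor, i.e. the ORDERED pair; corrected to the unordered pair the convention is about.)
[claim: Hu2025, status: under-review]
STATUS: candidate statement under adjudication (D-0012/D-0089); not asserted. -/
def Eq4_1 {α : Type y} (rel : T → 𝔗) (ends : T → α × α) : Prop :=
  Function.Injective fun t : T => (rel t, Sym2.mk (ends t).1 (ends t).2)

/-! ## Def. 4.3 continued (chunk p0021 l.110–120; p.46 L006–L010) — `R_[k]`, multi-homogeneous, ϱ-linear -/

/-- **Hu 2025, Def. 4.3, `R_[k]`** (chunk p0021 l.110–111; PDF p.46 L007): «`R_[k] = R_0[x_(v_s,u_s)]_{s ∈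
S_{F_i}, i ∈ [k]}`» — for a set `Φ` of relations in play (printed: `Φ = 𝓕_[k] = {F̄_1, …, F̄_k}`), the
`𝕜`-subalgebra of `R` of the polynomials whose variables are ϖ-variables or ϱ-variables of some `ℙ_F`,
`F ∈ Φ` (Mathlib `MvPolynomial.supported`: `f ∈ RSub rel Φ ↔ vars f ⊆ …`). `Φ = ∅` gives (the image of)
`R_0`, `Φ = univ` gives `⊤ = R`. [claim: Hu2025, status: under-review]
STATUS: candidate statement under adjudication (D-0012/D-0089); not asserted. -/
def RSub (rel : T → 𝔗) (Φ : Set 𝔗) : Subalgebra k (ModelRing σ T k) :=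
  MvPolynomial.supported k (Set.range (Sum.inl : σ → σ ⊕ T) ∪ Sum.inr '' (rel ⁻¹' Φ))

/-- **Hu 2025, Def. 4.3, `R_[k]`** — PARTITION name `Rk`, alias of `RSub` (chunk p0021 l.111; p.46 L007).
[claim: Hu2025, status: under-review]
STATUS: candidate statement under adjudication (D-0012/D-0089); not asserted. -/
abbrev Rk (rel : T → 𝔗) (Φ : Set 𝔗) : Subalgebra k (ModelRing σ T k) := RSub (k := k) (σ := σ) rel Φ

/-- **Hu 2025, Def. 4.3** — numbered alias of `RSub` (the rings `R_0 ⊂ R_[k]`; chunk p0021 l.107–111;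
p.46 L005–L006). The two adjectives of Def. 4.3 are `IsMultiHomogeneous` and `IsRhoLinear`.
[claim: Hu2025, status: under-review]
STATUS: candidate statement under adjudication (D-0012/D-0089); not asserted. -/
abbrev Def4_3 (rel : T → 𝔗) (Φ : Set 𝔗) : Subalgebra k (ModelRing σ T k) := RSub (k := k) (σ := σ) rel Φ

/-- The grading of `R` by the block `ℙ_F` (plumbing for Def. 4.3 «homogenous in `[x_(v_s,u_s)]_{s ∈
S_{F_i}}`», chunk p0021 l.113–114; p.46 L008): weight `1` on the ϱ-variables of `ℙ_F`, weight `0` on all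
other variables. [claim: Hu2025, status: under-review]
STATUS: candidate statement under adjudication (D-0012/D-0089); not asserted. -/
def blockWeight [DecidableEq 𝔗] (rel : T → 𝔗) (F : 𝔗) : σ ⊕ T → ℕ :=
  Sum.elim (fun _ => 0) fun t => if rel t = F then 1 else 0

/-- **Hu 2025, Def. 4.3, multi-homogeneous** (chunk p0021 l.113–114; PDF p.46 L008–L009): «A polynomial
`f ∈ R_[k]` is called multi-homogeneous if it is homogenous in `[x_(v_s,u_s)]_{s ∈ S_{F_i}}`, for every
`i ∈ [k]`» — for every block `F`, `f` is weighted-homogeneous (of some degree) for `blockWeight rel F`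
(Mathlib `MvPolynomial.IsWeightedHomogeneous`). Typed on all of `R` (for `f ∈ R_[k]` the blocks outside
`𝓕_[k]` carry degree `0`). [claim: Hu2025, status: under-review]
STATUS: candidate statement under adjudication (D-0012/D-0089); not asserted. -/
def IsMultiHomogeneous [DecidableEq 𝔗] (rel : T → 𝔗) (f : ModelRing σ T k) : Prop :=
  ∀ F : 𝔗, ∃ d : ℕ, IsWeightedHomogeneous (blockWeight rel F) f d

/-- **Hu 2025, Def. 4.3, ϱ-linear** (chunk p0021 l.116–120; PDF p.46 L009–L010): «A multi-homogeneous
polynomial `f ∈ R_[k]` is ϱ-linear if it is linear in `[x_(v_s,u_s)]_{s ∈ S_{F_i}}`, whenever it contains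
some ϱ-variables of `ℙ_{F_i}`, for any `i ∈ [k]`» — every block degree is `≤ 1` (degree `1` in the blocks
whose ϱ-variables occur, `0` in the others). [claim: Hu2025, status: under-review]
STATUS: candidate statement under adjudication (D-0012/D-0089); not asserted. -/
def IsRhoLinear [DecidableEq 𝔗] (rel : T → 𝔗) (f : ModelRing σ T k) : Prop :=
  ∀ F : 𝔗, ∃ d : ℕ, d ≤ 1 ∧ IsWeightedHomogeneous (blockWeight rel F) f d

/-! ## (4.7) and `ker^mh` (chunk p0021 l.122–140; p.46 L011–L019) -/

/-- The chart monomial `x̄_{u_s} x̄_{v_s} ∈ R_0` of the term `t` (chunk p0021 l.18, l.130; the `φ`-image of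
`x_(u_s,v_s)`), from its exponent vector `mono t` (with `x̄_m = 1` already applied, I-PL `xbar`). Plumbing.
[claim: Hu2025, status: under-review]
STATUS: candidate statement under adjudication (D-0012/D-0089); not asserted. -/
def img (mono : T → (σ →₀ ℕ)) (t : T) : R0 σ k :=
  monomial (mono t) 1

/-- **Hu 2025, (4.7), `φ_[k] : R_[k] → R_0` and `φ := φ_[Υ]`** (chunk p0021 l.122–136; PDF p.46 L011–L018):
«corresponding to the embedding (4.5), we have the degree two homomorphism `φ_[k] : R_[k] → R_0`,
`φ_[k]|_{R_0} = Id_{R_0}`; `x_(u_s,v_s) → x_{u_s} x_{v_s}` for all `s ∈ S_{F_i}`, `i ∈ [k]` … we set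
`R := R_[Υ]`, `φ := φ_[Υ]`.» — the `𝕜`-algebra map on `R` fixing the ϖ-variables and sending the
ϱ-variable of the term `t` to its chart monomial `img mono t`; `φ_[k]` is the restriction to `R_[k] ⊂ R`
(so p.46 L027–L028 «`f ∈ ker φ_[k] ⟺ f ∈ ker φ`» holds by construction). [claim: Hu2025, status: under-review]
STATUS: candidate statement under adjudication (D-0012/D-0089); not asserted. -/
def varphi (mono : T → (σ →₀ ℕ)) : ModelRing σ T k →ₐ[k] R0 σ k :=
  aeval (Sum.elim X (img mono))

/-- **Hu 2025, `ker^mh φ_[k]`** (chunk p0021 l.138–140; PDF p.46 L019): «We let `ker^mh φ_[k]` denote the set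
of all multi-homogeneous polynomials in `ker φ_[k]`» — as a subset of `R`: members of `R_Φ` that are
multi-homogeneous and killed by `φ`. [claim: Hu2025, status: under-review]
STATUS: candidate statement under adjudication (D-0012/D-0089); not asserted. -/
def kerMH [DecidableEq 𝔗] (rel : T → 𝔗) (mono : T → (σ →₀ ℕ)) (Φ : Set 𝔗) :
    Set (ModelRing σ T k) :=
  {f | f ∈ RSub (k := k) rel Φ ∧ IsMultiHomogeneous rel f ∧ varphi mono f = 0}

/-! ## (4.2)–(4.5): `Θ_[k]`, `Θ_{[k],Gr}`, the models `𝕌_[k]`, `𝒱_[k]` by their ideals -/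

/-- **Hu 2025, (4.2)/(4.5) rendered — the graph parametrisation of `Θ_[k]`** (chunk p0021 l.40–51 «the
natural rational map `Θ_[k] : 𝕌 ⇢ Π_{i ∈ [k]} ℙ_{F_i}`, `[x_u]_{u ∈ 𝕀_{3,n}} ⟶ Π_{i∈[k]} [x_u x_v]_{(u,v) ∈
Λ_{F_i}}`»; PDF p.44 L025–L034): over a quotient / extension `ev : R_0 → A` of the chart ring, the
`𝕜`-algebra map `ψ_A : R → A[t_F : F ∈ 𝔗]`, `x_u ↦ ev(x_u)`, `x_(u_s,v_s) ↦ ev(x̄_{u_s}x̄_{v_s})·t_F`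
(`F = rel t`). Its kernel (cut back to `R_[k]`) is the multi-homogeneous ideal of the closure of the graph
of `Θ_[k]` over `Spec A` — the rendering of «closure of the graph» used by `modelUIdeal` (`A = R_0`,
(4.5)) and `modelVIdeal` (`A = R_0/⟨𝓕⟩`, (4.3)/(4.4)). See the module docstring, RENDERING.
[claim: Hu2025, status: under-review]
STATUS: candidate statement under adjudication (D-0012/D-0089); not asserted. -/
def graphMap {A : Type y} [CommRing A] [Algebra k A] (rel : T → 𝔗) (mono : T → (σ →₀ ℕ))
    (ev : R0 σ k →ₐ[k] A) : ModelRing σ T k →ₐ[k] MvPolynomial 𝔗 A :=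
  aeval (Sum.elim (fun s => C (ev (X s))) fun t => C (ev (img mono t)) * X (rel t))

/-- **Hu 2025, (4.5), `𝕌_[k] ↪ ℛ_[k]`** (chunk p0021 l.78–87; PDF p.45 L008–L013): «As an intermediate toroidal
ambient space of `𝒱_[k]`, we let `𝕌_[k] ↪ ℛ_[k] := 𝕌 × Π_{i∈[k]} ℙ_{F_i}` be the closure of the graph of
the rational map `Θ_[k]`.» — carried by its ideal in `R`: generated by the elements of `R_Φ` in the kernel
of the graph parametrisation `ψ` over `R_0` itself (`graphMap` at `ev = id`).
[claim: Hu2025, status: under-review]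
STATUS: candidate statement under adjudication (D-0012/D-0089); not asserted. -/
def modelUIdeal (rel : T → 𝔗) (mono : T → (σ →₀ ℕ)) (Φ : Set 𝔗) : Ideal (ModelRing σ T k) :=
  Ideal.span {f | graphMap rel mono (AlgHom.id k (R0 σ k)) f = 0 ∧ f ∈ RSub (k := k) rel Φ}

/-- **Hu 2025, (4.3)/(4.4), `𝒱_[k] ↪ ℛ_[k]`** (chunk p0021 l.52–68; PDF p.44 L035–p.45 L003): «It restricts
to give rise to `Θ_{[k],Gr} : 𝕌_Gr ⇢ Π_{i∈[k]} ℙ_{F_i}` where recall that `𝕌_Gr := 𝕌 ∩ Gr^{3,E}`. We let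
`𝒱_[k] ↪ ℛ_[k] := 𝕌 × Π_{i∈[k]} ℙ_{F_i}` be the closure of the graph of the rational map `Θ_{[k],Gr}`.»
(and «`𝒱 := 𝒱_[Υ]`», p.45 L005, is `Φ = univ`) — carried by its ideal in `R`: generated by the elements of
`R_Φ` in the kernel of the graph parametrisation over the coordinate ring `R_0/⟨𝓕⟩` of `𝕌_Gr` (Prop. 3.6:
«`𝕌_Gr` … is defined by the relations in `𝓕`»; `𝓕 : Set (R0 σ k)` = I-PL `primaryFamily`).
[claim: Hu2025, status: under-review]
STATUS: candidate statement under adjudication (D-0012/D-0089); not asserted. -/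
def modelVIdeal (rel : T → 𝔗) (mono : T → (σ →₀ ℕ)) (𝓕 : Set (R0 σ k)) (Φ : Set 𝔗) :
    Ideal (ModelRing σ T k) :=
  Ideal.span {f | graphMap rel mono (Ideal.Quotient.mkₐ k (Ideal.span 𝓕)) f = 0 ∧
    f ∈ RSub (k := k) rel Φ}

/-! ## Lem. 4.4 (chunk «4.3», p0021 l.142–150; p.46 L020–L024) -/

/-- **Hu 2025, Lem. 4.4** (PDF numbering; chunk «Lemma 4.3» p0021 l.142–150; PDF p.46 L020–L024), verbatim:
«The scheme `𝕌_[k]`, as a closed subscheme of `ℛ_[k] = 𝕌 × Π_{i∈[k]} ℙ_{F_i}`, is defined by the ideal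
`ker^mh φ_[k]`. Proof. This is immediate.» At the carrier level of this file: the ideal of `𝕌_[k]`
(`modelUIdeal`, the closure of the graph of `Θ_[k]`) equals the ideal generated by `ker^mh φ_[k]`, for the
set `Φ` of relations in play (printed: `Φ = 𝓕_[k]`). [claim: Hu2025, status: under-review]
STATUS: candidate statement under adjudication (D-0012/D-0089); not asserted. -/
def Lem4_4 [DecidableEq 𝔗] (rel : T → 𝔗) (mono : T → (σ →₀ ℕ)) (Φ : Set 𝔗) : Prop :=
  modelUIdeal (k := k) rel mono Φ = Ideal.span (kerMH (k := k) rel mono Φ)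

/-- **Hu 2025, unnumbered claim p.47 L014–L015** (chunk p0022 l.5–6, argument chunk p0021 l.166–p0022 l.4;
PDF p.46 L030–p.47 L015): «Thus, regardless of the characteristic of the field `𝕜`, it suffices to consider
binomials `m − m′ ∈ ker^mh φ_[k]`.» READING (the printed argument groups the monomials of `f ∈ ker^mh
φ_[k]` by equal `φ`-image and rewrites each group as a sum of differences): every element of
`ker^mh φ_[k]` is a `𝕜`-linear combination of differences of two monomials `m − m′` that themselves lie in
`ker^mh φ_[k]`. [claim: Hu2025, status: under-review]
STATUS: candidate statement under adjudication (D-0012/D-0089); not asserted. -/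
def C22L5 [DecidableEq 𝔗] (rel : T → 𝔗) (mono : T → (σ →₀ ℕ)) (Φ : Set 𝔗) : Prop :=
  ∀ f ∈ kerMH (k := k) rel mono Φ,
    f ∈ Submodule.span k {b : ModelRing σ T k | b ∈ kerMH (k := k) rel mono Φ ∧
      ∃ a a' : σ ⊕ T →₀ ℕ, b = monomial a 1 - monomial a' 1}

/-! ## Lem. 4.5 / (4.8), Def. 4.6, Def. 4.7 (chunk «4.4»–«4.6», p0022 l.10–45; p.47 L017–L032) -/

/-- **Hu 2025, the binomial of (4.8)** (chunk p0022 l.13–18; PDF p.47 L018–L019): «`x_{u′}x_{v′}x_(u,v) −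
x_u x_v x_(u′,v′)`» for two ϱ-variables `x_(u,v)` (term `t`) and `x_(u′,v′)` (term `t′`) of the same `ℙ_F`:
`x̄_{u′}x̄_{v′} · x_t − x̄_u x̄_v · x_{t′}` in `R` (chart monomials via `mono`, `x̄_m = 1`).
[claim: Hu2025, status: under-review]
STATUS: candidate statement under adjudication (D-0012/D-0089); not asserted. -/
def wpBinomial (mono : T → (σ →₀ ℕ)) (t t' : T) : ModelRing σ T k :=
  toModel (img mono t') * rhoVar t - toModel (img mono t) * rhoVar t'

/-- **Hu 2025, Lem. 4.5 / (4.8)** (PDF numbering; chunk «Lemma 4.4» p0022 l.10–21; PDF p.47 L017–L022),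
verbatim: «Fix any `i ∈ [k]`. We have `x_{u′}x_{v′}x_(u,v) − x_u x_v x_(u′,v′) ∈ ker^mh φ̄_[k]` (4.8) where
`x_(u,v), x_(u′,v′)` are any two distinct ϱ-variables of `ℙ_{F_i}`. Proof. This is trivial.» -- sic: «`φ̄`»
(a bar the text never introduces; read `φ_[k]`, the only kernel in scope). For `Φ` the relations in play:
every such binomial with `F_i = rel t = rel t′ ∈ Φ`, `t ≠ t′`, lies in `ker^mh φ_Φ`.
[claim: Hu2025, status: under-review]
STATUS: candidate statement under adjudication (D-0012/D-0089); not asserted. -/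
def Lem4_5 [DecidableEq 𝔗] (rel : T → 𝔗) (mono : T → (σ →₀ ℕ)) (Φ : Set 𝔗) : Prop :=
  ∀ t t' : T, rel t = rel t' → t ≠ t' → rel t ∈ Φ →
    wpBinomial (k := k) mono t t' ∈ kerMH (k := k) rel mono Φ

/-- **Hu 2025, Def. 4.6, the ℘-binomials `B^℘_[k]`** (PDF numbering; chunk «Definition 4.5» p0022 l.23–27;
PDF p.47 L023–L025), verbatim: «Any nonzero binomial as in (4.8) is called a ℘-binomial of `R_[k]`. We let
`B^℘_[k]` denote the set of all ℘-binomials of `R_[k]`.» — the set of the NONZERO `wpBinomial mono t t′`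
with `rel t = rel t′ ∈ Φ`, `t ≠ t′`. [claim: Hu2025, status: under-review]
STATUS: candidate statement under adjudication (D-0012/D-0089); not asserted. -/
def wpBinomials (rel : T → 𝔗) (mono : T → (σ →₀ ℕ)) (Φ : Set 𝔗) : Set (ModelRing σ T k) :=
  {b | ∃ t t' : T, rel t = rel t' ∧ t ≠ t' ∧ rel t ∈ Φ ∧ b = wpBinomial (k := k) mono t t' ∧ b ≠ 0}

/-- **Hu 2025, Def. 4.6** — numbered alias of `wpBinomials` (PDF Def. 4.6 = chunk «Definition 4.5»,
p0022 l.23–27; p.47 L023–L025). [claim: Hu2025, status: under-review]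
STATUS: candidate statement under adjudication (D-0012/D-0089); not asserted. -/
abbrev Def4_6 (rel : T → 𝔗) (mono : T → (σ →₀ ℕ)) (Φ : Set 𝔗) : Set (ModelRing σ T k) :=
  wpBinomials (k := k) rel mono Φ

/-- The exponent vector of the chart monomial of the term `t`, moved into `R` (plumbing for Def. 4.7's
divisibilities «`x_{u′}x_{v′}x_(u,v) ∣ m`», read on exponents). [claim: Hu2025, status: under-review]
STATUS: candidate statement under adjudication (D-0012/D-0089); not asserted. -/
def monoR (mono : T → (σ →₀ ℕ)) (t : T) : σ ⊕ T →₀ ℕ :=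
  (mono t).mapDomain Sum.inl

/-- **Hu 2025, Def. 4.7, ℘-reducible** (PDF numbering; chunk «Definition 4.6» p0022 l.29–41; PDF p.47
L026–L031), verbatim: «Consider any nonzero binomial `f = m − m′ ∈ ker^mh φ_[k]`. We say that `f` is
℘-reducible if there exists `x_{u′}x_{v′}x_(u,v) − x_u x_v x_(u′,v′) ∈ B^℘_[k]` such that either
`x_{u′}x_{v′}x_(u,v) ∣ m` and `x_(u′,v′) ∣ m′`, or `x_(u,v) ∣ m` and `x_u x_v x_(u′,v′) ∣ m′`.» Typed on the
pair of monomials `(m, m′)` given by exponent vectors `a, a′` (so `f = monomial a 1 − monomial a′ 1`; the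
hypotheses «nonzero», «`∈ ker^mh φ_[k]`» are the consumer's); divisibility of monomials = `≤` of
exponents; the ℘-binomial is `wpBinomial mono t t′` with `rel t = rel t′ ∈ Φ`, `t ≠ t′`, nonzero.
[claim: Hu2025, status: under-review]
STATUS: candidate statement under adjudication (D-0012/D-0089); not asserted. -/
def IsWpReducible (rel : T → 𝔗) (mono : T → (σ →₀ ℕ)) (Φ : Set 𝔗) (a a' : σ ⊕ T →₀ ℕ) : Prop :=
  ∃ t t' : T, rel t = rel t' ∧ t ≠ t' ∧ rel t ∈ Φ ∧ wpBinomial (k := k) mono t t' ≠ 0 ∧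
    ((monoR mono t' + Finsupp.single (Sum.inr t) 1 ≤ a ∧ Finsupp.single (Sum.inr t') 1 ≤ a') ∨
      (Finsupp.single (Sum.inr t) 1 ≤ a ∧ monoR mono t + Finsupp.single (Sum.inr t') 1 ≤ a'))

/-- **Hu 2025, Def. 4.7, ℘-irreducible** (chunk p0022 l.43–45; PDF p.47 L032): «We say `f` is ℘-irreducible
if it is not ℘-reducible.» [claim: Hu2025, status: under-review]
STATUS: candidate statement under adjudication (D-0012/D-0089); not asserted. -/
def IsWpIrreducible (rel : T → 𝔗) (mono : T → (σ →₀ ℕ)) (Φ : Set 𝔗) (a a' : σ ⊕ T →₀ ℕ) : Prop :=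
  ¬ IsWpReducible (k := k) rel mono Φ a a'

/-- **Hu 2025, Def. 4.7** — numbered alias of `IsWpReducible` (PDF Def. 4.7 = chunk «Definition 4.6»,
p0022 l.29–45; p.47 L026–L032). [claim: Hu2025, status: under-review]
STATUS: candidate statement under adjudication (D-0012/D-0089); not asserted. -/
abbrev Def4_7 (rel : T → 𝔗) (mono : T → (σ →₀ ℕ)) (Φ : Set 𝔗) (a a' : σ ⊕ T →₀ ℕ) : Prop :=
  IsWpReducible (k := k) rel mono Φ a a'

end Literature.AlgebraicGeometry.Hu2025.Statements.S04ModelV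

end
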